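import Mathlib.Algebra.BigOperators.Group.Finset.Basic
import Mathlib.Algebra.Order.BigOperators.Group.Finset
import Mathlib.Algebra.Ring.Parity
import Mathlib.Algebra.Group.Int.Even
import Mathlib.Data.Finset.Card
import Mathlib.Tactic.Linarith
import Mathlib.Tactic.NormNum
import Mathlib.Tactic.Ring
import Mathlib.Tactic.IntervalCases
import Mathlib.Tactic.Positivity
import HarnessLib

/-!
# The (0,1) cell of the ι-window, XIV: the ODD-TORSION sub-branch of the push-forward row — PROPOSITION OT-A (pure invertible divisorial
# torsion is void), the RIGIDITY INEQUALITY (R), PROPOSITION OT-C (the genus squeeze on the factorial members) and COROLLARY EB″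
# (the cover object fails WIT) — algebraic skeleton

Family `hodge`, b2b cell `hweil` (helper of item stmt-HodgeConjecture-2524). Report
`run/shared/lean/b2b/hodge-weil/b2b-hweil-pv1-g26/H2-ZERO-ONE-14.md` (prover 1 gen 26). Companion to `WeilTypeLadderH2EvenBranchVoid.lean` (gen 25:
LEMMA ODM, THEOREM EB, LEMMA OT), `WeilTypeLadderH2LeadAVoid.lean` (gen 24: THEOREM LA, LOCAL INDEX LEMMA) and
`WeilTypeLadderH2EquivariantSemiregularity.lean` (gen 23: THEOREM U). HONEST FRAMING: exclusion results inside the ladder's H2 test ((0,1) cell),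
on the cover side of the push-forward row; no case of the Hodge conjecture is proved; nothing here is a rung; no statement of [Markman 2025] or
[Perry 2026] is used as a fact. The kernel content is the (elementary) arithmetic of the report; the geometry is the quoted print (Grothendieck–
Lefschetz for the Picard group of an effective ample divisor on a smooth projective fourfold — Hartshorne, *Ample Subvarieties*, Ch. IV Thm. 3.1 with
Thm. 1.5, SGA 2 XII Cor. 3.6; H. Lange, *Abelian Varieties over the Complex Numbers* (Text Edition 2023) Prop. 2.3.15; Mukai's Fourier transform) and
the cell's certified / proposed items (holomorphic Lefschetz at isolated fixed points, the push-forward dictionary, LEMMA ODM, LEMMA OT).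

## Setting (report §0)

`X` a ppav fourfold, `η ∈ X̂[2] ∖ 0`, `ρ : X̃ → X` the étale double cover (deck translation `τ = t_y`, `y ∈ K(L̃)`), `θ̃ = ρ^*θ` of type
`(1,1,1,2)` (`θ̃⁴ = 48`), `ι′ ∈ {−1, t_y ∘ (−1)}`. The cover object of a rank-2 (0,1) sheaf `F ≅ F ⊗ P_η` is `G̃`: simple, `ι′`-equivariant, RANK
ONE, `ch G̃ = w̃ = (1,0,−1,1,0)` in the basis `(1, θ̃, θ̃²/2, θ̃³/6, pt)`, `t_x(G̃) = ±1` at the 256 fixed points, `ι′`-RIGID. ODD-TORS: torsion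
`T ≠ 0`, `Ḡ = G̃/T = 𝓘_W ⊗ L`, `L = Q(−D)` with `Q = det G̃ ∈ Pic⁰`, `D = D(T)` the divisorial cycle of class `dθ̃`; `T′ ⊂ T` the part of dimension
`≤ 2` (surface class `t′·θ̃²/2`), `M = T/T′` pure of dimension 3.

## What is kernel-checked

* `ota_*` — PROPOSITION OT-A (report §2): if `M ≅ i_*(N|_D)` is invertible on its support then `N = L̃^k ⊗ P` by Grothendieck–Lefschetz, the class
  bookkeeping gives `s_T = t′ + 2kd` (`ota_surface_class`), so for pure `T` (`t′ = 0`) the residual value `s_T = −1` is impossible and `s_T ≥ 1`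
  forces `k ≥ 1` (`ota_pure_forces_k_pos`); then (OT3) makes the `2(k+d)⁴ − 2k⁴ ≥ 30` sections of `N ⊗ L^{-1}|_D` inject into `H¹(T′ ⊗ L^{-1}) = 0`
  (`ota_sections_d_one`, `ota_sections_monotone`, `ota_void`); the negative range `k ≤ −d` forces `t′ ≥ 2d² − 1` (`ota_negative_range`).
* `otb_*` — the class table of the factorial shape (α) (report §3): `T = i_*(𝓘_Z ⊗ L̃^k P|_D)`, `d = 1` (`otb_restriction_coefficients`,
  `otb_class_table`).
* `otc_*` — the RIGIDITY INEQUALITY (R) and PROPOSITION OT-C (report §4): the pair Euler characteristic `χ(Ḡ,T)` (`otc_euler_pair`,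
  `otc_euler_pair_alpha`), the pointwise Lefschetz bound `(1 − τ)(τ − 2o) ≤ −2o` for `τ ∈ 4ℤ`, `o ∈ {0,1}` (`otc_lefschetz_pointwise`) and its sum
  (`otc_lefschetz_sum`), the inequality `χ(Ḡ,T) ≥ 14 − 2ε − 2r₃` (`otc_rigidity_inequality`), the genus squeeze
  `h¹(𝒪_Z) ≥ 24k² + 24k + 8 + 8z − 2r₃` (`otc_h1_lower_bound`) and its two immediate kills (`otc_no_finite_Z`, `otc_z_one_excluded`).
* `ebpp_*` — COROLLARY EB″ (report §5): `χ(G̃ ⊗ L̃^k) = 2k⁴ − 12k² + 8k` vanishes exactly for `k ∈ {0, 2}` (`ebpp_rank_zero_iff`), `ch₃` of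
  `w̃·e^{kθ̃}` is the odd number `k³ − 3k + 1` (`ebpp_ch3_odd`), the index vector of the Fourier transform of `G̃` is supported at ONE point of
  `X̃^[2]` (`ebpp_transform_support`, `ebpp_dual_index`), Lange's count for one odd elementary divisor is `≥ 64` (`ebpp_forced_count_s_one`), and a
  torsion-cohomology transform would need `|t| ≥ 2` at `≥ 64` points (`ebpp_single_point_contradiction`).
-/

-- mandated namespace `Summit.HodgeConjecture.HodgeConjecture.…` (Problem = Summit) trips `linter.dupNamespace`; the lakefile disables it
-- tree-wide (weak option), restated here so stand-alone elaboration is warning-free too.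
set_option linter.dupNamespace false

namespace Summit.HodgeConjecture.HodgeConjecture.WeilTypeLadder

section OddTorsion

open Finset

/-- **PROPOSITION OT-A, class bookkeeping (report §2.2).** In the basis `(1, θ̃, θ̃²/2, θ̃³/6, pt)` write `ch₂(G̃) = −1`, `ch₂(T′) = t′`
(the surface class of the lower-dimensional part of the torsion), `ch₂(i_*(N|_D)) = c₁(N)·D − D²/2 = 2kd − d²` for `N = L̃^k ⊗ P`
(Grothendieck–Lefschetz: every line bundle on the effective ample divisor `D` is restricted from `X̃`, and `Pic X̃ / Pic⁰ = ℤL̃` on the very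
general `(1,1,1,2)` fourfold), `ch₂(Ḡ) = ch₂(L) − [W]₂ = d² − ω₂`. Additivity of `ch₂` on `0 → T → G̃ → Ḡ → 0` and `0 → T′ → T → i_*N|_D → 0`
forces `[W]₂ = ω₂ = 1 + t′ + 2kd`, i.e. the residual parameter of LEMMA OT (`ω₂ = 1 + s_T`) is **`s_T = t′ + 2kd`**. [new] -/
theorem ota_surface_class (d k t' ω₂ sT : ℤ) (hadd : (-1 : ℤ) = t' + (2 * k * d - d ^ 2) + (d ^ 2 - ω₂)) (hs : ω₂ = 1 + sT) :
    ω₂ = 1 + t' + 2 * k * d ∧ sT = t' + 2 * k * d := by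
  constructor <;> linarith

/-- **PROPOSITION OT-A, the parity step (report §2.3).** For PURE torsion (`t′ = 0`) the residual parameter is `s_T = 2kd`, an even
number: the branch `s_T = −1` ('`W` without surface part') is impossible, `s_T = 0` is REMARK LA′ (excluded), and `s_T ≥ 1` together with
`s_T ≥ −1` forces, for `d ≥ 1`, **`k ≥ 1`** — the invertible sheaf on `D` is a POSITIVE power of the polarisation. [new] -/
theorem ota_pure_forces_k_pos (d k sT : ℤ) (hd : 1 ≤ d) (hs : sT = 2 * (k * d)) (hres : -1 ≤ sT) (hLA : sT ≠ 0) :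
    sT ≠ -1 ∧ 1 ≤ k := by
  have hm0 : 0 ≤ k * d := by omega
  have hm1 : k * d ≠ 0 := fun h => hLA (by rw [hs, h]; ring)
  have hm : 1 ≤ k * d := by omega
  refine ⟨by omega, ?_⟩
  by_contra hk
  have hk' : k ≤ 0 := by omega
  have : k * d ≤ 0 := by nlinarith
  omega

/-- **PROPOSITION OT-A, the section count for `d = 1` (report §2.3).** `h⁰(D, L̃^{k+1}β|_D) = h⁰(L̃^{k+1}β) − h⁰(L̃^kβ′) = 2(k+1)⁴ − 2k⁴`
(`h⁰` of a line bundle of type `(m,m,m,2m)` is `2m⁴`; `H¹(L̃^kβ′) = 0` for `k ≥ 1`) equals `8k³ + 12k² + 8k + 2`, at least `30` for `k ≥ 1`.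
[new] -/
theorem ota_sections_d_one (k : ℤ) (hk : 1 ≤ k) :
    2 * (k + 1) ^ 4 - 2 * k ^ 4 = 8 * k ^ 3 + 12 * k ^ 2 + 8 * k + 2 ∧ 30 ≤ 2 * (k + 1) ^ 4 - 2 * k ^ 4 := by
  have h2 : 1 ≤ k ^ 2 := by nlinarith
  have h3 : 1 ≤ k ^ 3 := by nlinarith
  constructor
  · ring
  · nlinarith

/-- **PROPOSITION OT-A, monotonicity in `d` (report §2.3).** For `d ≥ 1` and `k ≥ 0` the count `2(k+d)⁴ − 2k⁴` is at least the `d = 1`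
count, so `h⁰(D, N ⊗ L^{-1}|_D) ≥ 30` whenever `k ≥ 1`, `d ≥ 1`. [new] -/
theorem ota_sections_monotone (k d : ℕ) (hd : 1 ≤ d) : (k + 1) ^ 4 ≤ (k + d) ^ 4 := by
  have : k + 1 ≤ k + d := by omega
  exact Nat.pow_le_pow_left this 4

/-- **PROPOSITION OT-A (report §2.1, §2.3): pure invertible divisorial torsion is VOID.** (OT3) of LEMMA OT says that every global
section of `T ⊗ L^{-1}` is annihilated by `𝓘_W`; a section of the PURE three-dimensional sheaf `M ⊗ L^{-1}` annihilated by `𝓘_W` would be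
supported in `W ∩ supp M`, of dimension `≤ 2`, hence is zero, so `H⁰(M ⊗ L^{-1}) ↪ H¹(T′ ⊗ L^{-1})`, i.e. `h⁰ ≤ h¹(T′ ⊗ L^{-1})`. For pure
torsion `T′ = 0`, and `h⁰ = 2(k+d)⁴ − 2k⁴ ≥ 30`: contradiction. Hence on the odd-torsion branch **the torsion of the cover object is never of
the form `i_*M` with `M` invertible on an effective Cartier divisor** (any `d ≥ 1`; `D` may be reducible or non-reduced). [new] -/
theorem ota_void (h0 h1T' : ℤ) (hinj : h0 ≤ h1T') (hpure : h1T' = 0) (hbig : 30 ≤ h0) : False := by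
  omega

/-- **PROPOSITION OT-A′, the negative range (report §2.4).** If the invertible part is a NON-positive twist with `k ≤ −d` then
`s_T = t′ + 2kd ≥ −1` forces `t′ ≥ 2d² − 1 ≥ 1`: the lower-dimensional part `T′` of the torsion carries a surface of degree
`≥ 24(2d² − 1)`. [new] -/
theorem ota_negative_range (d k t' sT : ℤ) (hd : 1 ≤ d) (hk : k ≤ -d) (hs : sT = t' + 2 * k * d) (hres : -1 ≤ sT) :
    2 * d ^ 2 - 1 ≤ t' := by
  nlinarith

/-- **Shape (α), the restriction coefficients (report §3.2).** `ch(i_*𝒪_D(kθ̃)) = e^{kθ̃}·(1 − e^{−θ̃})` in the basis `(1, θ̃, θ̃²/2, θ̃³/6, pt)`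
of the `(1,1,1,2)` fourfold (structure constants `θ̃·θ̃ = 2·(θ̃²/2)`, `θ̃·θ̃²/2 = 3·(θ̃³/6)`, `θ̃·θ̃³/6 = 8 pt`, `(θ̃²/2)² = 12 pt`; `e^{kθ̃} =
(1, k, k², k³, 2k⁴)`, `1 − e^{−θ̃} = (0, 1, −1, 1, −2)`): the coefficients are `(0, 1, 2k − 1, 3k² − 3k + 1, 8k³ − 12k² + 8k − 2)`. [new] -/
theorem otb_restriction_coefficients (k : ℤ) :
    (1 : ℤ) * (-1) + k * 1 * 2 = 2 * k - 1 ∧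
    (1 : ℤ) * 1 + k * (-1) * 3 + k ^ 2 * 1 * 3 = 3 * k ^ 2 - 3 * k + 1 ∧
    (1 : ℤ) * (-2) + k * 1 * 8 + k ^ 2 * (-1) * 12 + k ^ 3 * 1 * 8 = 8 * k ^ 3 - 12 * k ^ 2 + 8 * k - 2 := by
  refine ⟨by ring, by ring, by ring⟩

/-- **Shape (α), the class table (report §3.2).** With `d = 1`, `T = i_*(𝓘_Z ⊗ L̃^kP|_D)` (so `ch T = (0, 1, 2k−1, 3k²−3k+1−z,
8k³−12k²+8k−2−χ_Z)` with `[Z]₁ = z·θ̃³/6`, `χ_Z = χ(𝒪_Z(kθ̃))`) the three identities of `ot_class_bookkeeping` (LEMMA OT, gen 25: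
`−1 − a = d² − ω₂`, `1 − b = −d³ + 3dω₂ − ω₃`, `−c = 2d⁴ − 12d²ω₂ + 8dω₃ − ω₄`) give `ch(𝒪_W) = (0, 0, 2k+1, 3k²+3k+2−z,
8k³+12k²+8k+4−8z−χ_Z)`: `W` has a surface part of class `(2k+1)·θ̃²/2`. [new] -/
theorem otb_class_table (k z χZ a b c ω₂ ω₃ ω₄ : ℤ) (ha : a = 2 * k - 1) (hb : b = 3 * k ^ 2 - 3 * k + 1 - z)
    (hc : c = 8 * k ^ 3 - 12 * k ^ 2 + 8 * k - 2 - χZ) (h2 : -1 - a = 1 - ω₂) (h3 : 1 - b = -1 + 3 * ω₂ - ω₃)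
    (h4 : -c = 2 - 12 * ω₂ + 8 * ω₃ - ω₄) :
    ω₂ = 2 * k + 1 ∧ ω₃ = 3 * k ^ 2 + 3 * k + 2 - z ∧ ω₄ = 8 * k ^ 3 + 12 * k ^ 2 + 8 * k + 4 - 8 * z - χZ := by
  refine ⟨by linarith, by linarith, by linarith⟩

/-- **The pair Euler characteristic (report §4.1).** `χ(Ḡ, T) = ∫ ch(Ḡ)^∨·ch(T)` with `ch T = (0, d, a, b, c)` and `ch(Ḡ)^∨ =
(1, d, −1−a, b−1, −c)` is, by the structure constants of the `(1,1,1,2)` fourfold, `c + 8db + 12a(−1−a) + 8d(b−1)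
= c + 16db − 8d − 12a(1+a)`. [new] -/
theorem otc_euler_pair (d a b c : ℤ) :
    1 * c + d * b * 8 + (-1 - a) * a * 12 + (b - 1) * d * 8 + (-c) * 0 = c + 16 * d * b - 8 * d - 12 * a * (1 + a) := by
  ring

/-- **The pair Euler characteristic in shape (α) (report §4.1).** Substituting the class table (`d = 1`, `a = 2k−1`, `b = 3k²−3k+1−z`,
`c = 8k³−12k²+8k−2−χ_Z`): `χ(Ḡ,T) = 8k³ − 12k² − 16k + 6 − 16z − χ_Z`. [new] -/
theorem otc_euler_pair_alpha (k z χZ : ℤ) :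
    (8 * k ^ 3 - 12 * k ^ 2 + 8 * k - 2 - χZ) + 16 * 1 * (3 * k ^ 2 - 3 * k + 1 - z) - 8 * 1
      - 12 * (2 * k - 1) * (1 + (2 * k - 1)) = 8 * k ^ 3 - 12 * k ^ 2 - 16 * k + 6 - 16 * z - χZ := by
  ring

/-- **RIGIDITY INEQUALITY (R), the pointwise Lefschetz bound (report §4.2).** At a fixed point `x`, `t_x(Ḡ) = e(x)(1 − τ_x)` and
`t_x(T) = e(x)(τ_x − 2o_x)` with `τ_x = t_x(𝒪_W) ∈ 4ℤ` (LOCAL INDEX LEMMA / ODM (a): `dim W ≤ 2`) and `o_x = mult_x D(T) mod 2` (ODM (b)),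
`e(x)² = 1`; the local term of holomorphic Lefschetz for `R𝓗om(Ḡ,T)` is `(1 − τ_x)(τ_x − 2o_x)/16`, and **`(1 − τ)(τ − 2o) ≤ −2o`** for every
`τ ∈ 4ℤ`, `o ∈ {0,1}`. [new] -/
theorem otc_lefschetz_pointwise (τ o : ℤ) (hτ : (4 : ℤ) ∣ τ) (ho : o = 0 ∨ o = 1) : (1 - τ) * (τ - 2 * o) ≤ -2 * o := by
  obtain ⟨m, rfl⟩ := hτ
  rcases ho with rfl | rfl
  · have key : 0 ≤ m * (4 * m - 1) := by
      by_cases hm : 1 ≤ m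
      · exact mul_nonneg (by omega) (by omega)
      · exact mul_nonneg_of_nonpos_of_nonpos (by omega) (by omega)
    nlinarith [key]
  · have key : 0 ≤ m * (4 * m - 3) := by
      by_cases hm : 1 ≤ m
      · exact mul_nonneg (by omega) (by omega)
      · exact mul_nonneg_of_nonpos_of_nonpos (by omega) (by omega)
    nlinarith [key]

/-- **RIGIDITY INEQUALITY (R), the summed Lefschetz bound (report §4.2).** Summing the pointwise bound over the 256 fixed points:
`16·L(Ḡ,T) = Σ_x (1 − τ_x)(τ_x − 2o_x) ≤ −2·#{x : mult_x D odd}`; with Lange's count (`≥ 112` half-periods of odd multiplicity for `d` odd,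
gen-25 `ebv_forced_count`) `L(Ḡ,T) ≤ −14`. [new] -/
theorem otc_lefschetz_sum (f o : Fin 256 → ℤ) (h : ∀ i, f i ≤ -2 * o i) (hodd : 112 ≤ ∑ i, o i) :
    ∑ i, f i ≤ -2 * ∑ i, o i ∧ ∑ i, f i ≤ -224 := by
  have hpt : ∀ i ∈ (Finset.univ : Finset (Fin 256)), f i + (o i + o i) ≤ 0 := fun i _ => by have := h i; linarith
  have hsum : ∑ i, (f i + (o i + o i)) ≤ 0 := Finset.sum_nonpos hpt
  have hsplit : ∑ i, (f i + (o i + o i)) = ∑ i, f i + (∑ i, o i + ∑ i, o i) := by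
    rw [Finset.sum_add_distrib, Finset.sum_add_distrib]
  constructor
  · linarith
  · linarith

/-- **RIGIDITY INEQUALITY (R) (report §4.3).** For PURE torsion with `End(T)^+` of dimension `ε` (`= 1` for `M_D` of rank one on an
integral normal `D`): `Ext⁰(Ḡ,T) = 0` (OT1), `Ext⁴(Ḡ,T) = Hom(T,Ḡ)^∨ = 0`, `ext¹(Ḡ,T)^+ = ε` (OT1: `Ext¹(Ḡ,T)^+ = δ(End T^+)`), `r₃ :=
ext³(Ḡ,T)^+ = ext¹(T,Ḡ)^+`; so `χ^+(Ḡ,T) = −ε + ext²_+ − r₃ ≥ −ε − r₃`, and `χ(Ḡ,T) = 2χ^+ − L(Ḡ,T)` with `L ≤ −14` gives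
**`χ(Ḡ,T) ≥ 14 − 2ε − 2r₃`**. [new] -/
theorem otc_rigidity_inequality (χ L χp ε e2 r₃ : ℤ) (hsplit : χ + L = 2 * χp) (hchi : χp = -ε + e2 - r₃) (he2 : 0 ≤ e2)
    (hL : L ≤ -14) : 14 - 2 * ε - 2 * r₃ ≤ χ := by
  linarith

/-- **PROPOSITION OT-C, the genus squeeze (report §4.4).** In shape (α) (`ε = 1`): (R) reads `8k³ − 12k² − 16k + 6 − 16z − χ_Z ≥ 12 − 2r₃`
(`χ_Z = χ(𝒪_Z(kθ̃))`); the filling condition (OT3) gives `h⁰(𝒪_Z((k+1)θ̃)) ≥ 2(k+1)⁴ − 2k⁴ = 8k³ + 12k² + 8k + 2`; and `χ(𝒪_Z((k+1)θ̃)) =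
χ_Z + 8z` (`θ̃·[Z] = 8z`). Hence `h¹(𝒪_Z((k+1)θ̃)) = h⁰ − χ ≥ 24k² + 24k + 8 + 8z − 2r₃`, and `h¹(𝒪_Z) ≥ h¹(𝒪_Z((k+1)θ̃))` (a section of
the globally generated `L̃^{k+1}β` regular on `Z`): **`h¹(Z, 𝒪_Z) ≥ 24k² + 24k + 8 + 8z − 2r₃`**. [new] -/
theorem otc_h1_lower_bound (k z χZ r₃ h0 h1A h1 : ℤ) (hR : 12 - 2 * r₃ ≤ 8 * k ^ 3 - 12 * k ^ 2 - 16 * k + 6 - 16 * z - χZ)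
    (hfill : 8 * k ^ 3 + 12 * k ^ 2 + 8 * k + 2 ≤ h0) (hRR : h1A = h0 - (χZ + 8 * z)) (hmono : h1A ≤ h1) :
    24 * k ^ 2 + 24 * k + 8 + 8 * z - 2 * r₃ ≤ h1 := by
  linarith

/-- **PROPOSITION OT-C (i) (report §4.4): `Z` is not finite.** If `Z` were zero-dimensional then `z = 0` and `h¹(𝒪_Z) = 0`, so (with
`k ≥ 1`) `r₃ ≥ 28`: unless `Ext¹(T,Ḡ)^+` has dimension `≥ 28`, the filling subscheme `Z ⊂ D` contains a curve. [new] -/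
theorem otc_no_finite_Z (k r₃ h1 : ℤ) (hk : 1 ≤ k) (hbound : 24 * k ^ 2 + 24 * k + 8 + 8 * 0 - 2 * r₃ ≤ h1) (hfin : h1 = 0) :
    28 ≤ r₃ := by
  nlinarith

/-- **PROPOSITION OT-C (ii) (report §4.4): the curve class of `Z` is not `θ̃³/6`.** If `z = 1` the one-dimensional part of `Z` is a reduced
irreducible curve mapping birationally onto a curve of class `2γ` on the very general ppav `X` (a `2:1` image would have the minimal class `γ`,
excluded by Matsusaka–Ran), so `h¹(𝒪_Z) ≤ p_a ≤ 9` by Welters' classification (report [12] 9.3); but the squeeze with `k ≥ 1`, `r₃ = 0` demands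
`h¹(𝒪_Z) ≥ 64`. [new] -/
theorem otc_z_one_excluded (k h1 : ℤ) (hk : 1 ≤ k) (hbound : 24 * k ^ 2 + 24 * k + 8 + 8 * 1 - 2 * 0 ≤ h1) (hWelters : h1 ≤ 9) :
    False := by
  nlinarith

/-- **COROLLARY EB″, the rank of the Fourier transform (report §5.1).** `χ(G̃ ⊗ L̃^k) = ∫ w̃·e^{kθ̃} = 2k⁴ − 12k² + 8k = 2k(k − 2)(k² + 2k − 2)`,
which vanishes for an integer `k` exactly when `k ∈ {0, 2}`: the Fourier–Mukai transform of `G̃ ⊗ L̃^k ⊗ α` on the dual `(1,2,2,2)` fourfold has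
rank zero precisely for these two twists. [new] -/
theorem ebpp_rank_zero_iff (k : ℤ) : 2 * k ^ 4 - 12 * k ^ 2 + 8 * k = 0 ↔ k = 0 ∨ k = 2 := by
  constructor
  · intro h
    have hfac : 2 * k * (k - 2) * (k ^ 2 + 2 * k - 2) = 0 := by
      have : 2 * k * (k - 2) * (k ^ 2 + 2 * k - 2) = 2 * k ^ 4 - 12 * k ^ 2 + 8 * k := by ring
      rw [this]; exact h
    rcases mul_eq_zero.mp hfac with h12 | h3
    · rcases mul_eq_zero.mp h12 with h1 | h2
      · left
        have : (2 : ℤ) ≠ 0 := by norm_num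
        rcases mul_eq_zero.mp h1 with h0 | h0
        · exact absurd h0 this
        · exact h0
      · right; linarith
    · exfalso
      have hk1 : -3 ≤ k := by nlinarith
      have hk2 : k ≤ 1 := by nlinarith
      interval_cases k <;> omega
  · rintro (rfl | rfl) <;> norm_num

/-- **COROLLARY EB″, the first Chern class of the transform (report §5.1).** The coefficient of `θ̃³/6` in `w̃·e^{kθ̃}` is `k³ − 3k + 1`
(from `1·k³`, `−(θ̃²/2)·kθ̃ = −3k·θ̃³/6`, `θ̃³/6·1`), an ODD integer for every `k` (`k³ − k = (k−1)k(k+1)` is even); so `c₁` of the transform is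
an odd multiple of the dual polarisation class `θ̂` of type `(1,2,2,2)` — exactly ONE odd elementary divisor. [new] -/
theorem ebpp_ch3_odd (k : ℤ) : 1 * k ^ 3 + (-1) * k * 3 + 1 * 1 = k ^ 3 - 3 * k + 1 ∧ Odd (k ^ 3 - 3 * k + 1) := by
  refine ⟨by ring, ?_⟩
  have h1 : Even (k * (k + 1)) := Int.even_mul_succ_self k
  have h2 : Even ((k - 1) * (k * (k + 1)) - 2 * k) := by
    apply Even.sub
    · exact h1.mul_left (k - 1)
    · exact even_two_mul k
  have h3 : (k - 1) * (k * (k + 1)) - 2 * k = k ^ 3 - 3 * k := by ring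
  rw [h3] at h2
  exact h2.add_one

/-- **COROLLARY EB″, Lange's count for one odd elementary divisor (report §5.2).** [La23] Prop. 2.3.15 with `g = 4`, `s = 1`: the number of
half-periods of odd multiplicity on a non-trivial symmetric divisor of type `(m, 2m, 2m, 2m)`, `m` odd, is `2⁶·3 = 192`, `2⁶·1 = 64` or
`2⁷ = 128`; in every case at least `64`. [quoted print; arithmetic new] -/
theorem ebpp_forced_count_s_one (N : ℕ) (hN : N = 2 ^ (8 - 1 - 1) * (2 ^ 1 + 1) ∨ N = 2 ^ (8 - 1 - 1) * (2 ^ 1 - 1) ∨ N = 2 ^ (8 - 1)) :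
    (N = 192 ∨ N = 64 ∨ N = 128) ∧ 64 ≤ N := by
  rcases hN with rfl | rfl | rfl <;> norm_num

/-- **COROLLARY EB″, the index vector of the transform (report §5.2).** `t(G̃) = ±e` with `e` a `±1`-valued character of the fixed-point
group (determinant square (D): `t_x(G̃)` is the action of `ι′` on `(det G̃)_x = Q_x`); the character sum `t̂(χ) = Σ_x χ(x)t_x` equals `±256` at
`χ = e` (`Σ e(x)·(±e(x)) = ±256`), and Parseval `Σ_χ t̂(χ)² = 256·Σ_x t_x² = 256²` then forces `t̂(χ) = 0` for every other character: the
local indices `t̂/16` of the Fourier transform are `±16` at ONE fixed point of the dual involution and `0` at the other 255. [new] -/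
theorem ebpp_transform_support (hat : Fin 256 → ℤ) (χ₀ : Fin 256) (hpars : ∑ χ, hat χ ^ 2 = 256 * 256)
    (hpeak : hat χ₀ = 256 ∨ hat χ₀ = -256) : ∀ χ, χ ≠ χ₀ → hat χ = 0 := by
  have hpeak2 : hat χ₀ ^ 2 = 256 * 256 := by rcases hpeak with h | h <;> rw [h] <;> norm_num
  have hsplit : ∑ χ, hat χ ^ 2 = hat χ₀ ^ 2 + ∑ χ ∈ Finset.univ.erase χ₀, hat χ ^ 2 := by
    rw [← Finset.add_sum_erase Finset.univ (fun χ => hat χ ^ 2) (Finset.mem_univ χ₀)]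
  have hrest : ∑ χ ∈ Finset.univ.erase χ₀, hat χ ^ 2 = 0 := by linarith
  have hnonneg : ∀ χ ∈ Finset.univ.erase χ₀, 0 ≤ hat χ ^ 2 := fun χ _ => by positivity
  have hall := (Finset.sum_eq_zero_iff_of_nonneg hnonneg).mp hrest
  intro χ hχ
  have hmem : χ ∈ Finset.univ.erase χ₀ := Finset.mem_erase.mpr ⟨hχ, Finset.mem_univ χ⟩
  have := hall χ hmem
  exact pow_eq_zero_iff (n := 2) (by norm_num) |>.mp this

/-- **COROLLARY EB″, consistency of the dual index (report §5.2).** The transform `Ĝ = Φ(G̃)` is simple, rigid (`e₁ = 0`) with `e₂ = 12`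
and `χ(Ĝ,Ĝ) = 12`, so its Lefschetz energy is `χ_ι̂ = 2e₂ − 4e₁ − 8 = 16` and `Σ t² = 16·16 = 256 = 16²`: one fixed point with `|t| = 16`
exhausts the cap. [new] -/
theorem ebpp_dual_index (e1 e2 χι : ℤ) (he1 : e1 = 0) (he2 : e2 = 12) (hχ : χι = 2 * e2 - 4 * e1 - 8) :
    χι = 16 ∧ 16 * χι = 16 ^ 2 ∧ (256 : ℤ) / 16 = 16 := by
  subst he1; subst he2; subst hχ; norm_num

/-- **COROLLARY EB″ (report §5.3): the transform is not a (shifted) torsion sheaf — `G̃ ⊗ L̃^k ⊗ α` fails WIT for `k ∈ {0,2}`.** If all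
cohomology sheaves of `Φ(G̃ ⊗ L̃^k ⊗ α)` (`k ∈ {0,2}`, rank 0) were torsion, their total divisorial cycle would be a symmetric divisor whose class
is an ODD multiple of `θ̂` (type with one odd elementary divisor), so by Lange ≥ 64 fixed points have odd multiplicity and there, by LEMMA ODM
(complex form, gen 25), `t ≡ 2 (mod 4)`, `t² ≥ 4`; but the index vector of the transform vanishes at 255 of the 256 fixed points. [new] -/
theorem ebpp_single_point_contradiction (t : Fin 256 → ℤ) (x₀ : Fin 256) (hsupp : ∀ i, i ≠ x₀ → t i = 0) (S : Finset (Fin 256))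
    (hS : 64 ≤ S.card) (hbig : ∀ i ∈ S, 4 ≤ t i ^ 2) : False := by
  have hcard : 1 < S.card := by omega
  obtain ⟨i, hiS, hne⟩ := Finset.exists_mem_ne hcard x₀
  have h0 : t i = 0 := hsupp i hne
  have h4 := hbig i hiS
  rw [h0] at h4
  norm_num at h4

end OddTorsion

section OddTorsionAddendum

/-!
### ADDENDUM 1 (report §9): the two-sided WINDOW for `χ⁺(Ḡ,T)` from (OT2) and the exact count `e₂^{ι′}(G̃) = 12`, the sharpened genus
squeeze, and the Pareschi–Popa instances of shape (α)

In the E₁ page of the filtration `T ⊂ G̃` (three columns), (OT2) says `d₁ : (Ext¹(T,T) ⊕ Ext¹(Ḡ,Ḡ))⁺ → Ext²(Ḡ,T)⁺` is injective (rank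
`e := e_T + e_Ḡ`), and the total-degree-2 graded piece `E_∞^{1,1} = Ext²(Ḡ,T)⁺ / (im d₁ + im d₂)` embeds in `Ext²(G̃,G̃)⁺`, of dimension `12`;
with `ext²(Ḡ,T)⁺ = χ⁺(Ḡ,T) + ε_T + r₃` (Ext⁰ = Ext⁴ = 0, `ext¹⁺ = ε_T`, `ext³⁺ = r₃`) this pins `χ⁺(Ḡ,T)` to the window
`[e − ε_T − r₃, e − ε_T + 12]` (`otw_window`). In shape (α) the lower edge sharpens PROPOSITION OT-C to
`h¹(𝒪_Z) ≥ 24k² + 24k + 8 + 8z − 2r₃ + 2e` (`otw_h1_sharpened`), and the Pareschi–Popa genus bound for non-degenerate curves in an irreducible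
ppav (J. reine angew. Math. 615 (2008), Thm. 2) evaluates, for a curve of θ-degree `8z` on the fourfold, to `γ ≤ 8z² + 2z`
(`otw_pareschi_popa_degree_8z`), which kills the reduced shapes with smooth (or Welters-nodal) components for `k = 1`, `z ∈ {2, 3}`
(`otw_z_two_reduced`, `otw_z_three_smooth`).
-/

/-- **WINDOW LEMMA (report 9.1).** For pure torsion: (OT2) gives `rank d₁ = e_T + e_Ḡ =: e` inside `Ext²(Ḡ,T)⁺`, the Massey differential
`d₂` has rank `≤ r₃ = ext¹(T,Ḡ)⁺`, and `E_∞^{1,1} ↪ Ext²(G̃,G̃)⁺` (dimension `12`); so `ext²(Ḡ,T)⁺ − e − r₃ ≤ 12`, while (OT2) alone gives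
`ext²(Ḡ,T)⁺ ≥ e`. With `ext²(Ḡ,T)⁺ = χ⁺ + ε_T + r₃` (`Ext⁰ = Ext⁴ = 0`, `ext¹⁺ = ε_T` by (OT1), `ext³⁺ = r₃` by Serre duality):
**`e − ε_T − r₃ ≤ χ⁺(Ḡ,T) ≤ e − ε_T + 12`.** [new] -/
theorem otw_window (χp εT r₃ e ext2p rk2 : ℤ) (hext2 : ext2p = χp + εT + r₃) (hOT2 : e ≤ ext2p) (hrk2 : rk2 ≤ r₃)
    (hcount : ext2p - e - rk2 ≤ 12) : e - εT - r₃ ≤ χp ∧ χp ≤ e - εT + 12 := by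
  constructor <;> linarith

/-- **PROPOSITION OT-C sharpened by (OT2) (report 9.1).** In shape (α) (`ε_T = 1`, `L(Ḡ,T) ≤ −14`) the lower edge of the window reads
`χ(Ḡ,T) = 2χ⁺ − L ≥ 2(e − 1 − r₃) + 14`, i.e. `8k³ − 12k² − 16k + 6 − 16z − χ_Z ≥ 12 − 2r₃ + 2e`; running the filling / Riemann–Roch
arithmetic of `otc_h1_lower_bound` with this input gives **`h¹(𝒪_Z) ≥ 24k² + 24k + 8 + 8z − 2r₃ + 2e`**, `e = e_T + e_Ḡ ≥ h⁰(N_{Z/D})⁺ +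
h⁰(N_W)⁺` (invariant embedded deformations of `Z ⊂ D` and of `W ⊂ X̃`). [new] -/
theorem otw_h1_sharpened (k z χZ r₃ e h0 h1A h1 : ℤ)
    (hR : 12 - 2 * r₃ + 2 * e ≤ 8 * k ^ 3 - 12 * k ^ 2 - 16 * k + 6 - 16 * z - χZ)
    (hfill : 8 * k ^ 3 + 12 * k ^ 2 + 8 * k + 2 ≤ h0) (hRR : h1A = h0 - (χZ + 8 * z)) (hmono : h1A ≤ h1) :
    24 * k ^ 2 + 24 * k + 8 + 8 * z - 2 * r₃ + 2 * e ≤ h1 := by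
  linarith

/-- **The Pareschi–Popa bound at θ-degree `8z` on a fourfold (report 9.2).** [Pareschi–Popa, *Castelnuovo theory and the geometric Schottky
problem*, J. reine angew. Math. 615 (2008), Thm. 2]: for an irreducible ppav of dimension `g` and a smooth curve of genus `γ` birational onto a
non-degenerate curve of degree `d`, `γ ≤ C(m+1,2)·g + (m+1)ε + 1` with `d − 1 = mg + ε`, strict for `g ≥ 3`, `d ≥ g + 2`. With `g = 4`,
`d = 8z` (any integer `z`; geometrically `z ≥ 1`): `m = 2z − 1`, `ε = 3`, and the strict bound is `γ ≤ C(2z,2)·4 + 2z·3 = 8z² + 2z` (`z = 1`: `10`; `z = 2`: `36`; `z = 3`: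
`78`). [quoted print; arithmetic new] -/
theorem otw_pareschi_popa_degree_8z (z : ℤ) :
    8 * z - 1 = (2 * z - 1) * 4 + 3 ∧ (2 * z * (2 * z - 1) / 2) * 4 + 2 * z * 3 + 1 - 1 = 8 * z ^ 2 + 2 * z := by
  refine ⟨by ring, ?_⟩
  have h : 2 * z * (2 * z - 1) / 2 = z * (2 * z - 1) := by
    rw [show 2 * z * (2 * z - 1) = z * (2 * z - 1) * 2 by ring]
    exact Int.mul_ediv_cancel _ (by norm_num)
  rw [h]; ring

/-- **OT-C (iv), the reduced shapes at `k = 1`, `z = 2`, `r₃ = 0` (report 9.2).** The squeeze demands `h¹(𝒪_Z) ≥ 24 + 24 + 8 + 16 = 72`.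
(a) `Z` irreducible smooth, birational onto a degree-16 curve: Pareschi–Popa `p_a = γ ≤ 36 < 72`; (b) `Z = ρ⁻¹(C)` étale double over a smooth
degree-8 curve (`γ ≤ 10`): `p_a = 2γ − 1 ≤ 19 < 72`; (c) `Z = Z₁ ∪ Z₂`, two lifts of Welters curves (`p_a ≤ 9` each): `Z₂` alone imposes
`≤ 16 + 1 < 30` conditions, so lies on a member `H₂` of `|L̃²β|_D|` with `H₂ ⊅ Z₁`, whence `length(Z₁ ∩ Z₂) ≤ Z₁·H₂ = 16` and
`p_a(Z) ≤ 9 + 9 + 16 − 1 = 33 < 72`. [new] -/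
theorem otw_z_two_reduced :
    (24 : ℤ) * 1 ^ 2 + 24 * 1 + 8 + 8 * 2 = 72 ∧ (8 : ℤ) * 2 ^ 2 + 2 * 2 = 36 ∧ (36 : ℤ) < 72 ∧
    (2 : ℤ) * 10 - 1 ≤ 19 ∧ (19 : ℤ) < 72 ∧ (16 : ℤ) + 1 < 30 ∧ (9 : ℤ) + 9 + 16 - 1 = 33 ∧ (33 : ℤ) < 72 := by
  norm_num

/-- **OT-C (iv) continued: `k = 1`, `z = 3`, smooth irreducible birational `Z` (report 9.2).** The squeeze demands `h¹(𝒪_Z) ≥ 80` while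
Pareschi–Popa at degree `24` gives `γ ≤ 78`: dead; at `z = 4` (`γ ≤ 136` vs `≥ 88`) the genus bound no longer decides. [new] -/
theorem otw_z_three_smooth :
    (24 : ℤ) * 1 ^ 2 + 24 * 1 + 8 + 8 * 3 = 80 ∧ (8 : ℤ) * 3 ^ 2 + 2 * 3 = 78 ∧ (78 : ℤ) < 80 ∧
    (8 : ℤ) * 4 ^ 2 + 2 * 4 = 136 ∧ ¬ ((136 : ℤ) < 24 * 1 ^ 2 + 24 * 1 + 8 + 8 * 4) := by
  norm_num

end OddTorsionAddendum

end Summit.HodgeConjecture.HodgeConjecture.WeilTypeLadder
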